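import Summits.QuantumFields.GaugeBoot.TiltedSiteRPPlaquettes
import HarnessLib

/-!
# Site frames: holonomies under the reflection, the action, the measure (gauge-boot, L3(τ) part 3)

HONEST FRAMING (cell `pub-gaugeboot`, page 1 of every file): the venture produces certified bounds
on lattice expectations at stated coupling, gauge group, dimension and torus size; NOT a mass gap,
NOT a continuum limit, NOT a string tension; NOT Yang–Mills-summit-bearing (barriers
`FixedCouplingUltralocality`, `PerturbativeInvisibility`).

Continuation of `TiltedSiteRPPlaquettes.lean` (site frame `IsSiteFrame e k θ P h`; Osterwalder–Seiler
reflection `Θ = configReflect e k θ` inverting the reversed `k`-links). Contents: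
`Re tr ρ((ΘU)_p) = Re tr ρ(U_{plaqReflect p})` — for a plaquette with a `k`-side the reflected
holonomy is `a⁻¹ · U_{p'}⁻¹ · a`, `a` the lowered `k`-link (conjugation and inversion do not change
`Re tr ρ`); the splitting `∑_p Re tr ρ(U_p) = A(U) + A(ΘU) + M(U)` (no cut plaquettes); invariance of
the Wilson action `S(ΘU) = S(U)`; `Θ` preserves the product Haar measure (relabelling of the links
composed with the inversion of the `k`-link variables; Haar measure of a compact group is inversion
invariant) and is measurable. The positivity theorem follows in `TiltedSiteRPPositivity.lean`.

References: K. Osterwalder, E. Seiler, Ann. Phys. 110 (1978) 440, §2; J. Fröhlich, R. Israel,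
E. H. Lieb, B. Simon, Comm. Math. Phys. 62 (1978) 1, Thm. 2.1.
-/

noncomputable section

open MeasureTheory Complex
open Literature.MathematicalPhysics.QuantumFieldTheory (haarProbability)
open Literature.RepresentationTheory.CompactGroups

namespace Summit.QuantumFields.GaugeBoot

namespace TiltedRP

namespace IsSiteFrame

variable {A : Type*} [AddCommGroup A] [Fintype A] {d : ℕ}
variable {e : Fin d → A} {k : Fin d} {θ : A →+ A} {P : ℕ} {h : A →+ ZMod (2 * P)}
variable (hF : IsSiteFrame e k θ P h)
variable {N : ℕ} {G : Type*} [Group G] [TopologicalSpace G] [IsTopologicalGroup G] [CompactSpace G]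
  [MeasurableSpace G] [BorelSpace G] [SecondCountableTopology G]
variable (ρ : G →* Matrix (Fin N) (Fin N) ℂ)
include hF

/-! ## Holonomies under the reflection -/

omit [Fintype A] [TopologicalSpace G] [IsTopologicalGroup G] [CompactSpace G] [MeasurableSpace G]
  [BorelSpace G] [SecondCountableTopology G] in
/-- A plaquette WITHOUT `k`-side: `(ΘU)_{x;l,m} = U_{θx;l,m}`. -/
theorem holonomy_configReflect_of_not_hasDir (U : Config A d G) {p : Plaq A d} (hp : ¬ HasDir p k) :
    holonomy e (configReflect e k θ U) p.1 p.2.1.1 p.2.1.2 =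
      holonomy e U (plaqReflect e k θ p).1 p.2.1.1 p.2.1.2 := by
  obtain ⟨x, ⟨⟨l, m⟩, hlm⟩⟩ := p
  simp only [HasDir, not_or] at hp
  rw [plaqReflect_fst_of_not_hasDir (by simpa [HasDir] using hp)]
  simp only [holonomy, configReflect_other e k θ _ _ hp.1, configReflect_other e k θ _ _ hp.2,
    hF.map_add_other _ hp.1, hF.map_add_other _ hp.2]

omit [Fintype A] [TopologicalSpace G] [IsTopologicalGroup G] [CompactSpace G] [MeasurableSpace G]
  [BorelSpace G] [SecondCountableTopology G] in
/-- A `(k, m)`-plaquette: `(ΘU)_{x;k,m} = a⁻¹ · (U_{y;k,m})⁻¹ · a`, `y = θx - e_k`, `a = U(y, k)`. -/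
theorem holonomy_configReflect_left (U : Config A d G) (x : A) {m : Fin d} (hm : m ≠ k) :
    holonomy e (configReflect e k θ U) x k m =
      (U (θ x - e k, k))⁻¹ * (holonomy e U (θ x - e k) k m)⁻¹ * U (θ x - e k, k) := by
  have h1 : configReflect e k θ U (x + e k, m) = U (θ x - e k, m) := by
    rw [configReflect_other e k θ U _ hm, hF.map_add_self]
  have h2 : configReflect e k θ U (x + e m, k) = (U (θ x - e k + e m, k))⁻¹ := by
    rw [configReflect_self, hF.map_add_other _ hm, add_sub_right_comm]
  have h3 : configReflect e k θ U (x, m) = U (θ x - e k + e k, m) := by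
    rw [configReflect_other e k θ U _ hm, sub_add_cancel]
  simp only [holonomy, configReflect_self, h1, h2, h3, mul_inv_rev, inv_inv]
  group

omit [Fintype A] [TopologicalSpace G] [IsTopologicalGroup G] [CompactSpace G] [MeasurableSpace G]
  [BorelSpace G] [SecondCountableTopology G] in
/-- An `(l, k)`-plaquette: `(ΘU)_{x;l,k} = a⁻¹ · (U_{y;l,k})⁻¹ · a`, `y = θx - e_k`, `a = U(y, k)`. -/
theorem holonomy_configReflect_right (U : Config A d G) (x : A) {l : Fin d} (hl : l ≠ k) :
    holonomy e (configReflect e k θ U) x l k =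
      (U (θ x - e k, k))⁻¹ * (holonomy e U (θ x - e k) l k)⁻¹ * U (θ x - e k, k) := by
  have h1 : configReflect e k θ U (x + e l, k) = (U (θ x - e k + e l, k))⁻¹ := by
    rw [configReflect_self, hF.map_add_other _ hl, add_sub_right_comm]
  have h2 : configReflect e k θ U (x + e k, l) = U (θ x - e k, l) := by
    rw [configReflect_other e k θ U _ hl, hF.map_add_self]
  have h3 : configReflect e k θ U (x, l) = U (θ x - e k + e k, l) := by
    rw [configReflect_other e k θ U _ hl, sub_add_cancel]
  simp only [holonomy, configReflect_self, h1, h2, h3, mul_inv_rev, inv_inv]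
  group

omit [Fintype A] [TopologicalSpace G] [IsTopologicalGroup G] [CompactSpace G] [MeasurableSpace G]
  [BorelSpace G] [SecondCountableTopology G] in
/-- A plaquette WITH a `k`-side: `(ΘU)_p = a⁻¹ · (U_{p'})⁻¹ · a`, `p' = plaqReflect p` (base point
`y = θx - e_k`), `a = U(y, k)`. -/
theorem holonomy_configReflect_of_hasDir (U : Config A d G) {p : Plaq A d} (hp : HasDir p k) :
    holonomy e (configReflect e k θ U) p.1 p.2.1.1 p.2.1.2 =
      (U (θ p.1 - e k, k))⁻¹ * (holonomy e U (plaqReflect e k θ p).1 p.2.1.1 p.2.1.2)⁻¹ *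
        U (θ p.1 - e k, k) := by
  obtain ⟨x, ⟨⟨l, m⟩, hlm⟩⟩ := p
  have hlm' : l ≠ m := ne_of_lt hlm
  rw [plaqReflect_fst_of_hasDir hp]
  simp only [HasDir] at hp
  rcases hp with hl | hm
  · have hl' := hl.symm
    subst hl'
    exact hF.holonomy_configReflect_left U x (fun h' => hlm' h'.symm)
  · have hm' := hm.symm
    subst hm'
    exact hF.holonomy_configReflect_right U x hlm'

omit [Fintype A] [MeasurableSpace G] [BorelSpace G] [SecondCountableTopology G] in
/-- **`Re tr ρ((ΘU)_p) = Re tr ρ(U_{plaqReflect p})`.** -/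
theorem plaqObs_configReflect (hρ : Continuous ρ) (p : Plaq A d) (U : Config A d G) :
    plaqObs ρ e p (configReflect e k θ U) = plaqObs ρ e (plaqReflect e k θ p) U := by
  unfold plaqObs
  rw [plaqReflect_snd]
  by_cases hp : HasDir p k
  · rw [hF.holonomy_configReflect_of_hasDir U hp]
    set a := U (θ p.1 - e k, k)
    set g := holonomy e U (plaqReflect e k θ p).1 p.2.1.1 p.2.1.2
    rw [show a⁻¹ * g⁻¹ * a = a⁻¹ * g⁻¹ * a⁻¹⁻¹ by rw [inv_inv], CompactGroup.trace_conj_eq,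
      CompactGroup.re_trace_map_inv ρ hρ]
  · rw [hF.holonomy_configReflect_of_not_hasDir U hp]

omit [Fintype A] [MeasurableSpace G] [BorelSpace G] [SecondCountableTopology G] in
/-- `Re tr ρ((ΘU)_{plaqReflect p}) = Re tr ρ(U_p)`. -/
theorem plaqObs_plaqReflect_configReflect (hρ : Continuous ρ) (p : Plaq A d) (U : Config A d G) :
    plaqObs ρ e (plaqReflect e k θ p) (configReflect e k θ U) = plaqObs ρ e p U := by
  rw [hF.plaqObs_configReflect ρ hρ, hF.plaqReflect_plaqReflect]

/-! ## Splitting the action -/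

open scoped Classical in
omit [MeasurableSpace G] [BorelSpace G] [SecondCountableTopology G] in
/-- The negative plaquettes contribute the positive ones of the reflected configuration. -/
theorem sum_neg_eq_sum_pos_configReflect (hρ : Continuous ρ) (U : Config A d G) :
    ∑ p ∈ Finset.univ.filter (IsSiteNegPlaq k P h), plaqObs ρ e p U =
      ∑ p ∈ Finset.univ.filter (IsSitePosPlaq k P h), plaqObs ρ e p (configReflect e k θ U) := by
  refine Finset.sum_nbij' (plaqReflect e k θ) (plaqReflect e k θ) (fun p hp => ?_) (fun p hp => ?_)
    (fun p _ => hF.plaqReflect_plaqReflect p) (fun p _ => hF.plaqReflect_plaqReflect p) fun p _ => ?_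
  · rw [Finset.mem_filter] at hp ⊢
    exact ⟨Finset.mem_univ _, (hF.isSitePosPlaq_plaqReflect_iff p).2 hp.2⟩
  · rw [Finset.mem_filter] at hp ⊢
    exact ⟨Finset.mem_univ _, (hF.isSiteNegPlaq_plaqReflect_iff p).2 hp.2⟩
  · rw [hF.plaqObs_plaqReflect_configReflect ρ hρ]

open scoped Classical in
omit [MeasurableSpace G] [BorelSpace G] [SecondCountableTopology G] in
/-- The mirror plaquettes contribute a `Θ`-invariant amount. -/
theorem sum_mirror_configReflect (hρ : Continuous ρ) (U : Config A d G) :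
    ∑ p ∈ Finset.univ.filter (IsSiteMirrorPlaq k P h), plaqObs ρ e p (configReflect e k θ U) =
      ∑ p ∈ Finset.univ.filter (IsSiteMirrorPlaq k P h), plaqObs ρ e p U :=
  Finset.sum_congr rfl fun p hp => by
    rw [hF.plaqObs_configReflect ρ hρ, hF.plaqReflect_of_isSiteMirrorPlaq (Finset.mem_filter.1 hp).2]

open scoped Classical in
omit [MeasurableSpace G] [BorelSpace G] [SecondCountableTopology G] in
/-- **Splitting of the plaquette sum along the two layers** (no cut plaquettes):
`∑_p Re tr ρ(U_p) = A(U) + A(ΘU) + M(U)`. -/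
theorem sum_plaqObs_split (hρ : Continuous ρ) (U : Config A d G) :
    ∑ p, plaqObs ρ e p U =
      ∑ p ∈ Finset.univ.filter (IsSitePosPlaq k P h), plaqObs ρ e p U +
      ∑ p ∈ Finset.univ.filter (IsSitePosPlaq k P h), plaqObs ρ e p (configReflect e k θ U) +
      ∑ p ∈ Finset.univ.filter (IsSiteMirrorPlaq k P h), plaqObs ρ e p U := by
  rw [← hF.sum_neg_eq_sum_pos_configReflect ρ hρ U]
  set Q : Finset (Plaq A d) := Finset.univ
  set f : Plaq A d → ℝ := fun p => plaqObs ρ e p U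
  have h1 := Finset.sum_filter_add_sum_filter_not Q (IsSitePosPlaq k P h) f
  have h2 := Finset.sum_filter_add_sum_filter_not (Q.filter fun p => ¬ IsSitePosPlaq k P h p)
    (IsSiteMirrorPlaq k P h) f
  have e2 : (Q.filter fun p => ¬ IsSitePosPlaq k P h p).filter (IsSiteMirrorPlaq k P h) =
      Q.filter (IsSiteMirrorPlaq k P h) := by
    rw [Finset.filter_filter]
    exact Finset.filter_congr fun p _ =>
      ⟨fun h' => h'.2, fun h' => ⟨fun h'' => hF.not_isSiteMirrorPlaq_of_isSitePosPlaq h'' h', h'⟩⟩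
  have e3 : (Q.filter fun p => ¬ IsSitePosPlaq k P h p).filter (fun p => ¬ IsSiteMirrorPlaq k P h p) =
      Q.filter (IsSiteNegPlaq k P h) := by
    rw [Finset.filter_filter]
    exact Finset.filter_congr fun p _ => by unfold IsSiteNegPlaq; tauto
  rw [e2, e3] at h2
  linarith

omit [MeasurableSpace G] [BorelSpace G] [SecondCountableTopology G] in
/-- **The Wilson action is reflection invariant**: `S(ΘU) = S(U)`. -/
theorem wilsonAction_configReflect (hρ : Continuous ρ) (U : Config A d G) :
    wilsonAction ρ e (configReflect e k θ U) = wilsonAction ρ e U := by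
  rw [wilsonAction_eq, wilsonAction_eq]
  congr 1
  exact Fintype.sum_equiv (Function.Involutive.toPerm (plaqReflect e k θ) hF.plaqReflect_plaqReflect)
    _ _ fun p => hF.plaqObs_configReflect ρ hρ p U

/-! ## The reflection preserves the product Haar measure -/

/-- The reflection of links as a permutation. -/
def siteLinkPerm (hF : IsSiteFrame e k θ P h) : Equiv.Perm (Link A d) :=
  Function.Involutive.toPerm (siteLinkMap e k θ) hF.siteLinkMap_involutive

omit [Fintype A] [TopologicalSpace G] [IsTopologicalGroup G] [CompactSpace G] [MeasurableSpace G]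
  [BorelSpace G] [SecondCountableTopology G] hF in
/-- `configReflect` = (invert the `k`-link variables) ∘ (relabel the links by `siteLinkMap`). -/
theorem configReflect_eq_comp :
    (configReflect (G := G) e k θ : Config A d G → Config A d G) =
      (fun V l => (if l.2 = k then (fun g : G => g⁻¹) else id) (V l)) ∘
        fun U l => U (siteLinkMap e k θ l) := by
  funext U l
  simp only [configReflect, Function.comp_apply]
  split_ifs <;> rfl

omit [SecondCountableTopology G] in
/-- **The reflection preserves the product Haar measure.** -/
theorem measurePreserving_configReflect :
    MeasurePreserving (configReflect (G := G) e k θ) (productHaar A d G) (productHaar A d G) := by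
  haveI : IsProbabilityMeasure (haarProbability G) :=
    CompactGroup.isProbabilityMeasure_haarMeasure_top
  haveI : (haarProbability G).IsInvInvariant := by
    unfold haarProbability; exact CompactGroup.isInvInvariant_of_isHaarMeasure _
  have h1 : MeasurePreserving (fun U l => U (siteLinkMap e k θ l) : Config A d G → Config A d G)
      (productHaar A d G) (productHaar A d G) := by
    have h := measurePreserving_arrowCongr' (fun _ : Link A d => haarProbability G)
      (fun _ : Link A d => haarProbability G) hF.siteLinkPerm (MeasurableEquiv.refl G)
      fun _ => MeasurePreserving.id _
    have heq : (fun U l => U (siteLinkMap e k θ l) : Config A d G → Config A d G) =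
        ⇑(MeasurableEquiv.arrowCongr' hF.siteLinkPerm (MeasurableEquiv.refl G)) := by
      funext U l; rfl
    rw [heq]; exact h
  have h2 : MeasurePreserving
      (fun V l => (if l.2 = k then (fun g : G => g⁻¹) else id) (V l) : Config A d G → Config A d G)
      (productHaar A d G) (productHaar A d G) := by
    unfold productHaar
    refine measurePreserving_pi _ _ fun l => ?_
    split_ifs
    · exact Measure.measurePreserving_inv _
    · exact MeasurePreserving.id _
  rw [configReflect_eq_comp]
  exact h2.comp h1

omit [Fintype A] [TopologicalSpace G] [IsTopologicalGroup G] [CompactSpace G] [SecondCountableTopology G]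
  hF in
/-- The reflection of configurations is measurable. -/
theorem measurable_configReflect [MeasurableInv G] : Measurable (configReflect (G := G) e k θ) := by
  refine measurable_pi_lambda _ fun l => ?_
  by_cases hl : l.2 = k
  · simp only [configReflect, hl, ↓reduceIte]
    exact (measurable_pi_apply _).inv
  · simp only [configReflect, hl, ↓reduceIte]
    exact measurable_pi_apply _

end IsSiteFrame

end TiltedRP

end Summit.QuantumFields.GaugeBoot
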